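import Literature.NumberTheory.DiophantineGeometry.TateAlgorithmRingEquivProofs
import HarnessLib

/-!
# The conductor of a Weierstrass curve over `ℚ` — the `𝓞 ℚ` versus `ℤ` bridge (proofs)

Trunk `DiophValNum` (companion proof file of
`Literature.NumberTheory.DiophantineGeometry.Conductor`; theorems only).

The conductor `N_E = W.conductorNorm ℤ` of an elliptic curve `E/ℚ` is indexed in the tree by the
finite places of `ℤ`, while the Galois side (Artin conductors of `V_ℓ E`, item C15
`Literature.NumberTheory.EllipticCurves.HasseWeilAbelian`, and bsd.S15
`Literature.NumberTheory.EllipticCurves.BSDConductor`) is indexed by the finite places of `𝓞 ℚ`.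
The conductor exponent `f_v = W.conductorExponent v` (Ogg's formula `ord_v Δ_min + 1 - m_v`, with
`m_v` read off from Tate's algorithm `W.kodairaSymbolAt v`) depends on the place only through the
completed local ring `v.adicCompletionIntegers ℚ ≃ ℤ_[p]`, by
`WeierstrassCurve.ordMinimalDiscriminant_eq_padic` (discriminant half, Silverman AEC VII.1.3(b))
and `WeierstrassCurve.kodairaSymbolAt_eq_padic` (Kodaira-symbol half, equivariance of Tate's
algorithm under isomorphisms of DVRs).  Consequences proved here, for an elliptic `W / ℚ`:

* `WeierstrassCurve.conductorExponent_eq_padic` — `f_v` computed in `ℚ_[p]`, `p` the prime below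
  `v`, for any integer ring `R` of `ℚ`;
* `WeierstrassCurve.conductorExponent_eq_of_primesEquiv_eq` — `f_v = f_{v'}` for places `v`,
  `v'` of two integer rings of `ℚ` above the same prime; over `ℚ`:
  `WeierstrassCurve.conductorExponent_ringOfIntegers_eq`;
* `WeierstrassCurve.conductorNorm_eq_finprod_primes` — `W.conductorNorm R = ∏ᶠ p, p ^ f_p`, the
  right-hand side not mentioning `R`;
* `WeierstrassCurve.conductorNorm_ringOfIntegers_rat` — the bridge
  `W.conductorNorm (𝓞 ℚ) = W.conductorNorm ℤ`, consumed by
  `Literature.NumberTheory.EllipticCurves.BSDConductorProofs`.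

Ellipticity is assumed throughout (for singular `W` the Kodaira symbol is a model-dependent junk
value).  As in `Mathlib.NumberTheory.Padics.HeightOneSpectrum`, `Fact p.Prime` for
`p : Nat.Primes` is supplied inline by `haveI`.

## References

* J. H. Silverman, *Advanced Topics in the Arithmetic of Elliptic Curves*, GTM 151, 1994, §IV.10
  (Definition of the conductor of `E/K` as `𝔣(E/K) = ∏_𝔭 𝔭 ^ f(E/K_𝔭)`, PDF p. 364), §IV.11
  (Ogg's formula 11.1, PDF p. 365).
* J. H. Silverman, *The Arithmetic of Elliptic Curves*, GTM 106, 2nd ed. 2009, VII.1.3(b).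
-/

open IsDedekindDomain IsDiscreteValuationRing

namespace WeierstrassCurve

section Padic

open Rat.HeightOneSpectrum Literature.NumberTheory.DiophantineGeometry.MinimalDiscriminant

variable {R : Type*} [CommRing R] [IsDedekindDomain R] [Algebra R ℚ] [IsFractionRing R ℚ]
  [IsIntegralClosure R ℤ ℚ]

/-- `f_v` computed in `ℚ_p`: for an elliptic `W / ℚ` and a place `v` of an integer ring `R` of `ℚ`
above `p`, Ogg's formula evaluated over `ℤ_[p]`, `f_v = ord_p (Δ_min) + 1 - m (W ⊗ ℚ_p)`
(`ordMinimalDiscriminant_eq_padic` and `kodairaSymbolAt_eq_padic`).  Silverman, *ATAEC*, §IV.10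
(the exponent of the conductor of `E/K` at `𝔭` is that of `E/K_𝔭`) and IV.11.1. [folklore] -/
theorem conductorExponent_eq_padic (v : HeightOneSpectrum R) (W : WeierstrassCurve ℚ)
    [W.IsElliptic] :
    haveI : Fact (primesEquiv v).1.Prime := ⟨(primesEquiv v).2⟩
    W.conductorExponent v =
      (addVal ℤ_[primesEquiv v] (((W.baseChange ℚ_[primesEquiv v]).minimal
          ℤ_[primesEquiv v]).integralModel ℤ_[primesEquiv v]).Δ).toNat + 1 -
        ((W.baseChange ℚ_[primesEquiv v]).kodairaSymbol ℤ_[primesEquiv v]).numComponents := by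
  unfold conductorExponent numComponentsAt
  rw [ordMinimalDiscriminant_eq_padic, kodairaSymbolAt_eq_padic]

/-- The conductor exponents of an elliptic `W / ℚ` at places `v`, `v'` of two integer rings `R`,
`R'` of `ℚ` above the same prime agree (both are `f_p` computed in `ℚ_p`,
`conductorExponent_eq_padic`). [folklore] -/
theorem conductorExponent_eq_of_primesEquiv_eq {R' : Type*} [CommRing R'] [IsDedekindDomain R']
    [Algebra R' ℚ] [IsFractionRing R' ℚ] [IsIntegralClosure R' ℤ ℚ]
    (v : HeightOneSpectrum R) (v' : HeightOneSpectrum R') (W : WeierstrassCurve ℚ) [W.IsElliptic]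
    (hvv' : (primesEquiv v : Nat.Primes) = primesEquiv v') :
    W.conductorExponent v = W.conductorExponent v' := by
  rw [conductorExponent_eq_padic v W, conductorExponent_eq_padic v' W, hvv']

variable [Module.Free ℤ R]

/-- The conductor norm of an elliptic `W / ℚ` over any integer ring `R` of `ℚ` (`R = ℤ` or
`R = 𝓞 ℚ`) is `∏_p p ^ f_p` with `f_p` computed in `ℚ_p`; in particular it does not depend on
`R`.  Silverman, *ATAEC*, §IV.10, Definition of the conductor (PDF p. 364). [folklore] -/
theorem conductorNorm_eq_finprod_primes (W : WeierstrassCurve ℚ) [W.IsElliptic] :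
    W.conductorNorm R =
      ∏ᶠ p : Nat.Primes, haveI : Fact p.1.Prime := ⟨p.2⟩
        (p : ℕ) ^
          ((addVal ℤ_[p] (((W.baseChange ℚ_[p]).minimal ℤ_[p]).integralModel ℤ_[p]).Δ).toNat + 1 -
            ((W.baseChange ℚ_[p]).kodairaSymbol ℤ_[p]).numComponents) := by
  have _inst (p : Nat.Primes) : Fact p.1.Prime := ⟨p.2⟩
  unfold conductorNorm WeierstrassCurve.conductor
  have hcoe : ∀ I, (Ideal.absNorm (S := R)).toMonoidHom I = Ideal.absNorm I := fun _ ↦ rfl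
  have hmap := MonoidHom.map_finprod_of_preimage_one (Ideal.absNorm (S := R)).toMonoidHom
    (fun I hI ↦ by simpa [hcoe, Ideal.one_eq_top] using hI)
    (fun v : HeightOneSpectrum R ↦ v.asIdeal ^ W.conductorExponent v)
  simp only [hcoe, map_pow] at hmap
  rw [hmap]
  have hexp : ∀ v : HeightOneSpectrum R, W.conductorExponent v = _ :=
    fun v ↦ conductorExponent_eq_padic v W
  simp only [absNorm_asIdeal_eq_natGenerator, hexp]
  exact finprod_comp_equiv primesEquiv
    (f := fun p : Nat.Primes ↦ (p : ℕ) ^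
      ((addVal ℤ_[p] (((W.baseChange ℚ_[p]).minimal ℤ_[p]).integralModel ℤ_[p]).Δ).toNat + 1 -
        ((W.baseChange ℚ_[p]).kodairaSymbol ℤ_[p]).numComponents))

end Padic

section Rat

open NumberField

/-- **The `𝓞 ℚ` versus `ℤ` bridge for the conductor.**  For an elliptic `W / ℚ`,
`N_{ℚ/ℚ} 𝔣(E/ℚ)` computed over the ring of integers `𝓞 ℚ` equals the conductor
`N_E = W.conductorNorm ℤ` computed over `ℤ`: both are `∏_p p ^ f(E/ℚ_p)`
(`conductorNorm_eq_finprod_primes` for `R = 𝓞 ℚ` and `R = ℤ`), the exponent of the conductor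
at a prime being that of `E` over the completion (Silverman, *ATAEC*, §IV.10, Definition of the
conductor of `E/K` as `𝔣(E/K) = ∏_𝔭 𝔭 ^ f(E/K_𝔭)`, PDF p. 364).  The mathematical input is the
equivariance of Tate's algorithm under isomorphisms of DVRs
(`WeierstrassCurve.kodairaSymbolAt_eq_padic`) and Silverman AEC VII.1.3(b)
(`WeierstrassCurve.ordMinimalDiscriminant_eq_padic`); the bridge itself is folklore.
[cite: SilvermanATAEC1994, §IV.10 Definition of the conductor (PDF p. 364)] -/
theorem conductorNorm_ringOfIntegers_rat (W : WeierstrassCurve ℚ) [W.IsElliptic] :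
    W.conductorNorm (𝓞 ℚ) = W.conductorNorm ℤ := by
  rw [conductorNorm_eq_finprod_primes, conductorNorm_eq_finprod_primes]

/-- Exponentwise form of the bridge over `ℚ`: for an elliptic `W / ℚ` and a finite place `v` of
`𝓞 ℚ`, `f_v` equals `f_p` at the place of `ℤ` below the same prime
(`Rat.HeightOneSpectrum.primesEquiv`). [folklore] -/
theorem conductorExponent_ringOfIntegers_eq (W : WeierstrassCurve ℚ) [W.IsElliptic]
    (v : HeightOneSpectrum (𝓞 ℚ)) :
    W.conductorExponent v =
      W.conductorExponent
        ((Rat.HeightOneSpectrum.primesEquiv (R := ℤ)).symm (Rat.HeightOneSpectrum.primesEquiv v)) :=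
  conductorExponent_eq_of_primesEquiv_eq v _ W (by rw [Equiv.apply_symm_apply])

end Rat

end WeierstrassCurve
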